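import Summits.AtomisticToContinuum.HydrodynamicLimit.Theorems.EnskogAdjointDualityAdjointEnskogTestFamilyROperatorKappaZeroPrep
import Summits.AtomisticToContinuum.HydrodynamicLimit.Theorems.EnskogAdjointDualityAdjointEnskogTestFamilyRKernelBridge
import Summits.AtomisticToContinuum.HydrodynamicLimit.Theorems.EnskogAdjointDualityAdjointEnskogTestFamilyRKernelCritical
import Summits.AtomisticToContinuum.HydrodynamicLimit.Theorems.EnskogAdjointDualityAdjointEnskogTestFamilyRKernelDeloc
import HarnessLib

/-!
# K2R refutation, stub `operatorKappaZero` — preparation 3: the two kernel combinations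

Route `EnskogAdjointDuality` of `AtomisticToContinuum/HydrodynamicLimit`, crux K2R
`AdjointEnskogTestFamilyR` (stmt-AtomisticToContinuum-11592), line `refutation`, registered stub
`stub_operatorKappaZero`. Third preparation file (notation as in `…ROperatorKappaZeroPrep`: the
critical weight `Θ` with equation `hΘ`, the dual gain kernel `I` with equation `hI`). The sphere
integrals of the dual gain kernel are one-dimensional profiles (`stub_kernelBridge`), and the two
weighted `L¹` estimates `stub_kernelCritical` (K0) and `stub_kernelDeloc` (K2) of the refutation
skeleton become statements on `ℝ³`:

* (K0, `k2r_ref_ok0_K0`) there is `M₀` such that for every `R ≥ 1` the radial combination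
  `2∫_{S²} I₀^R(U, ω) dσ − ν(U) Θ₀^R(U)` (`ν = collisionFrequency`, a radial function) is `k(|U|²)`
  for a measurable `k` with `∫ (1+|U|²)|k(|U|²)| dU ≤ M₀`;
* (K2, `k2r_ref_ok0_K2`) there is `M₂` such that for every `R ≥ 1` the dipole moment
  `∫_{S²} ω₀ I₀^R(U, ω) dσ = U₀ (π/2 · Θ₀^R(U) + e(|U|²))` with `∫ |U₀|(1+|U|²)|e(|U|²)| dU ≤ M₂`;
* the two trigonometric remainders of the delocalisation phase on the sphere
  (`stub_operatorKappaZero_prep3`).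

References: C. Cercignani, R. Illner, M. Pulvirenti, *The Mathematical Theory of Dilute Gases* (1994),
§3.1, §7.2 [CIP1994].
-/

noncomputable section

open MeasureTheory Set Filter Function
open scoped InnerProductSpace Real

namespace Summit.AtomisticToContinuum.HydrodynamicLimit.Theorems.EnskogAdjointDuality

open Literature.MathematicalPhysics.KineticTheory Literature.Analysis.FluidPDE Literature.Analysis.FunctionSpaces
open Literature.Analysis.UnboundedOperators (collisionFrequency)

variable {Θ : ℝ → V3 → ℝ} {I : ℝ → V3 → V3 → ℝ}
variable (hΘ : ∀ R v, Θ R v = ((1 + ‖v‖ ^ 2) ^ 3)⁻¹ * Real.exp (-‖v‖ ^ 2 / R))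
  (hI : ∀ R U n, I R U n = (1 / 2 : ℝ) * Real.exp (-(‖U‖ ^ 2 - ⟪U, n⟫_ℝ ^ 2) / 2) *
    (∫ b, max (⟪U, n⟫_ℝ - b) 0 * (Real.exp (-b ^ 2 / 2) / Real.sqrt (2 * π))) *
    ∫ E in Ioi (⟪U, n⟫_ℝ ^ 2), ((1 + E) ^ 3)⁻¹ * Real.exp (-E / R))
include hΘ hI

omit hΘ hI in
/-- The half-Gaussian moment `h` and the radial collision frequency `n(u) = ν(u e₀)`: the hypotheses
of `stub_kernelCritical` / `stub_kernelDeloc` (from `stub_halfGaussian`), and `|u e₀| = u`. [folklore] -/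
theorem k2r_ref_ok0_hn :
    Continuous (fun a : ℝ => ∫ b, max (a - b) 0 * (Real.exp (-b ^ 2 / 2) / Real.sqrt (2 * π))) ∧
    (∀ a : ℝ, 0 ≤ (∫ b, max (a - b) 0 * (Real.exp (-b ^ 2 / 2) / Real.sqrt (2 * π))) - max a 0 ∧
      (∫ b, max (a - b) 0 * (Real.exp (-b ^ 2 / 2) / Real.sqrt (2 * π))) - max a 0 ≤ Real.exp (-a ^ 2 / 2)) ∧
    (∀ a : ℝ, (∫ b, max (a - b) 0 * (Real.exp (-b ^ 2 / 2) / Real.sqrt (2 * π))) -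
      (∫ b, max (-a - b) 0 * (Real.exp (-b ^ 2 / 2) / Real.sqrt (2 * π))) = a) ∧
    Measurable (fun u : ℝ => collisionFrequency (u • (EuclideanSpace.single 0 1 : V3))) ∧
    (∀ u : ℝ, 0 ≤ u → π * u ≤ collisionFrequency (u • (EuclideanSpace.single 0 1 : V3)) ∧
      collisionFrequency (u • (EuclideanSpace.single 0 1 : V3)) ≤ π * Real.sqrt (u ^ 2 + 3)) ∧
    (∀ u : ℝ, 0 ≤ u → ‖u • (EuclideanSpace.single 0 1 : V3)‖ = u) := by
  obtain ⟨⟨hhc, -, -⟩, hh, -, -, -, hcf⟩ := stub_halfGaussian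
  have hnorm : ∀ u : ℝ, 0 ≤ u → ‖u • (EuclideanSpace.single 0 1 : V3)‖ = u := fun u hu => by
    rw [norm_smul, Real.norm_of_nonneg hu]
    simp
  refine ⟨hhc, fun a => ⟨(hh a).1, (hh a).2.1⟩, fun a => (hh a).2.2,
    Literature.Analysis.UnboundedOperators.measurable_collisionFrequency.comp
      (continuous_id.smul continuous_const).measurable, fun u hu => ?_, hnorm⟩
  have h := hcf (u • (EuclideanSpace.single 0 1 : V3))
  rw [hnorm u hu] at h
  exact ⟨h.1, h.2.1⟩

omit hΘ in
/-- Measurability of the sphere moments `U ↦ ∫_{S²} c(ω) I₀^R(U, ω) dσ` for a continuous weight `c`.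
[folklore] -/
theorem k2r_ref_ok0_measurable_moment {R : ℝ} (hR : 0 < R) {c : Metric.sphere (0 : V3) 1 → ℝ}
    (hc : Continuous c) :
    Measurable fun U : V3 => ∫ ω, c ω * I R U ω ∂(sphereMeasure : Measure (Metric.sphere (0 : V3) 1)) := by
  haveI := isFiniteMeasure_sphereMeasure (E := V3)
  have hIc := k2r_ref_ok0_continuous_I hI hR
  have hG : Continuous fun q : V3 × Metric.sphere (0 : V3) 1 => c q.2 * I R q.1 q.2 :=
    (hc.comp continuous_snd).mul (hIc.comp (continuous_fst.prodMk (continuous_subtype_val.comp continuous_snd)))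
  exact (hG.stronglyMeasurable.integral_prod_right'
    (ν := (sphereMeasure : Measure (Metric.sphere (0 : V3) 1)))).measurable

/-- **(K0) The critical kernel combination on `ℝ³`.** There is `M₀` such that for every `R ≥ 1`
there is a measurable `k` with `k(|U|²) = 2∫_{S²} I₀^R(U, ω) dσ − ν(U) Θ₀^R(U)` for all `U`
(`∫_{S²} I₀^R dσ = g₀(|U|²)` by `stub_kernelBridge`, `ν` radial), `(1+|U|²)|k(|U|²)|` integrable and
`∫ (1+|U|²)|k(|U|²)| dU ≤ M₀` (polar coordinates and `stub_kernelCritical`). [cite: CIP1994, §7.2] -/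
theorem k2r_ref_ok0_K0 : ∃ M₀ : ℝ, ∀ R : ℝ, 1 ≤ R → ∃ k : ℝ → ℝ, Measurable k ∧
    (∀ U : V3, k (‖U‖ ^ 2) = 2 * (∫ ω, I R U ω ∂(sphereMeasure : Measure (Metric.sphere (0 : V3) 1))) -
      collisionFrequency U * Θ R U) ∧
    Integrable (fun U : V3 => (1 + ‖U‖ ^ 2) * |k (‖U‖ ^ 2)|) ∧
    ∫ U : V3, (1 + ‖U‖ ^ 2) * |k (‖U‖ ^ 2)| ≤ M₀ := by
  haveI := isFiniteMeasure_sphereMeasure (E := V3)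
  obtain ⟨hhc, hhb, -, hnm, hnb, hnorm⟩ := k2r_ref_ok0_hn
  set e₀ : V3 := EuclideanSpace.single 0 1 with he₀
  set n : ℝ → ℝ := fun u => collisionFrequency (u • e₀) with hn
  obtain ⟨M₀, hM₀⟩ := stub_kernelCritical _ hhc hhb n hnm hnb
  refine ⟨2 * π * M₀, fun R hR => ?_⟩
  have hR0 : 0 < R := by linarith
  obtain ⟨hKi, hKle⟩ := hM₀ R hR
  obtain ⟨hU, hpol, -⟩ := stub_kernelBridge stub_sphereCalculus.1 R hR
  -- the profile `g₀` and the sphere integral of the kernel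
  set g0 : ℝ → ℝ := fun E => π * ∫ t in (-1 : ℝ)..1, Real.exp (-(E * (1 - t ^ 2)) / 2) *
    (∫ b, max (Real.sqrt E * t - b) 0 * (Real.exp (-b ^ 2 / 2) / Real.sqrt (2 * π))) *
    ∫ E' in Ioi (E * t ^ 2), ((1 + E') ^ 3)⁻¹ * Real.exp (-E' / R) with hg0
  have hΓ : ∀ U : V3, ∫ ω, I R U ω ∂(sphereMeasure : Measure (Metric.sphere (0 : V3) 1)) = g0 (‖U‖ ^ 2) := by
    intro U
    have h := (hU U).2.2.1
    simp only [hI, hg0]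
    beta_reduce at h
    exact h
  -- the kernel
  set k : ℝ → ℝ := fun E => 2 * (∫ ω, I R (Real.sqrt E • e₀) ω ∂(sphereMeasure : Measure (Metric.sphere (0 : V3) 1))) -
    n (Real.sqrt E) * (((1 + E) ^ 3)⁻¹ * Real.exp (-E / R)) with hk
  have hkm : Measurable k := by
    have hΓm := k2r_ref_ok0_measurable_moment hI hR0 (c := fun _ => (1 : ℝ)) continuous_const
    simp only [one_mul] at hΓm
    have h1 : Measurable fun E : ℝ => Real.sqrt E • e₀ := (Real.continuous_sqrt.smul continuous_const).measurable
    have h2 : Measurable fun E : ℝ => ((1 + E) ^ 3)⁻¹ * Real.exp (-E / R) := by fun_prop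
    exact ((hΓm.comp h1).const_mul 2).sub ((hnm.comp Real.continuous_sqrt.measurable).mul h2)
  have hk0 : ∀ E : ℝ, 0 ≤ E → k E = 2 * g0 E - n (Real.sqrt E) * (((1 + E) ^ 3)⁻¹ * Real.exp (-E / R)) := by
    intro E hE
    simp only [hk]
    rw [hΓ, hnorm _ (Real.sqrt_nonneg E), Real.sq_sqrt hE]
  have hkU : ∀ U : V3, k (‖U‖ ^ 2) = 2 * (∫ ω, I R U ω ∂(sphereMeasure : Measure (Metric.sphere (0 : V3) 1))) -
      collisionFrequency U * Θ R U := by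
    intro U
    rw [hk0 _ (sq_nonneg _), hΓ U, Real.sqrt_sq (norm_nonneg U), hΘ]
    simp only [hn]
    rw [ClampedCorrectorBirth.collisionFrequency_eq_of_norm_eq (hnorm _ (norm_nonneg U))]
  -- transfer of the one-dimensional estimate
  have heq : EqOn (fun E => (1 + E) * Real.sqrt E * |2 * g0 E - n (Real.sqrt E) * (((1 + E) ^ 3)⁻¹ * Real.exp (-E / R))|)
      (fun E => (1 + E) * Real.sqrt E * |k E|) (Ioi 0) := fun E hE => by
    beta_reduce
    rw [hk0 E (le_of_lt hE)]
  have hKi' : IntegrableOn (fun E => (1 + E) * Real.sqrt E * |k E|) (Ioi 0) := by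
    refine IntegrableOn.congr_fun ?_ heq measurableSet_Ioi
    simpa only [hg0] using hKi
  obtain ⟨hint, hval⟩ := hpol k hkm hKi'
  refine ⟨k, hkm, hkU, hint, ?_⟩
  rw [hval, ← setIntegral_congr_fun measurableSet_Ioi heq]
  have hle : ∫ E in Ioi (0 : ℝ), (1 + E) * Real.sqrt E *
      |2 * g0 E - n (Real.sqrt E) * (((1 + E) ^ 3)⁻¹ * Real.exp (-E / R))| ≤ M₀ := by
    simpa only [hg0] using hKle
  nlinarith [hle, Real.pi_pos]

/-- **(K2) The delocalisation (dipole) moment of the dual gain kernel on `ℝ³`.** There is `M₂` such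
that for every `R ≥ 1` there is a measurable `e` with
`∫_{S²} ω₀ I₀^R(U, ω) dσ(ω) = U₀ (π/2 · Θ₀^R(U) + e(|U|²))` for all `U` (zeroth component of
`∫ I₀ ω dσ = (g₂(|U|²)/|U|) U`, `stub_kernelBridge`), `|U₀|(1+|U|²)|e(|U|²)|` integrable and
`∫ |U₀|(1+|U|²)|e(|U|²)| dU ≤ M₂` (polar coordinates and `stub_kernelDeloc`). [cite: CIP1994, §3.1] -/
theorem k2r_ref_ok0_K2 : ∃ M₂ : ℝ, ∀ R : ℝ, 1 ≤ R → ∃ e : ℝ → ℝ, Measurable e ∧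
    (∀ U : V3, ∫ ω, (ω : V3) 0 * I R U ω ∂(sphereMeasure : Measure (Metric.sphere (0 : V3) 1)) =
      U 0 * (π / 2 * Θ R U + e (‖U‖ ^ 2))) ∧
    Integrable (fun U : V3 => |U 0| * (1 + ‖U‖ ^ 2) * |e (‖U‖ ^ 2)|) ∧
    ∫ U : V3, |U 0| * (1 + ‖U‖ ^ 2) * |e (‖U‖ ^ 2)| ≤ M₂ := by
  haveI := isFiniteMeasure_sphereMeasure (E := V3)
  obtain ⟨hhc, hhb, hanti, -, -, hnorm⟩ := k2r_ref_ok0_hn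
  set e₀ : V3 := EuclideanSpace.single 0 1 with he₀
  obtain ⟨M₂, hM₂⟩ := stub_kernelDeloc _ hhc hhb hanti
  refine ⟨π * M₂, fun R hR => ?_⟩
  have hR0 : 0 < R := by linarith
  obtain ⟨hDi, hDle⟩ := hM₂ R hR
  obtain ⟨hU, -, hpol⟩ := stub_kernelBridge stub_sphereCalculus.1 R hR
  obtain ⟨-, hIsec⟩ := k2r_ref_ok0_continuous_I' hI hR0
  -- the profile `g₂` and the dipole moment of the kernel
  set g2 : ℝ → ℝ := fun E => π * ∫ t in (-1 : ℝ)..1, t * Real.exp (-(E * (1 - t ^ 2)) / 2) *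
    (∫ b, max (Real.sqrt E * t - b) 0 * (Real.exp (-b ^ 2 / 2) / Real.sqrt (2 * π))) *
    ∫ E' in Ioi (E * t ^ 2), ((1 + E') ^ 3)⁻¹ * Real.exp (-E' / R) with hg2
  have hvec : ∀ U : V3, ∫ ω, I R U ω • (ω : V3) ∂(sphereMeasure : Measure (Metric.sphere (0 : V3) 1)) =
      (g2 (‖U‖ ^ 2) / ‖U‖) • U := by
    intro U
    have h := (hU U).2.2.2.1
    simp only [hI, hg2]
    beta_reduce at h
    exact h
  have hΓ₂ : ∀ U : V3, ∫ ω, (ω : V3) 0 * I R U ω ∂(sphereMeasure : Measure (Metric.sphere (0 : V3) 1)) =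
      g2 (‖U‖ ^ 2) / ‖U‖ * U 0 := by
    intro U
    have hint : Integrable (fun ω : Metric.sphere (0 : V3) 1 => I R U ω • (ω : V3)) sphereMeasure :=
      ClampedCorrectorBirth.integrable_sphere_of_continuous' ((hIsec U).smul continuous_subtype_val)
    calc ∫ ω, (ω : V3) 0 * I R U ω ∂(sphereMeasure : Measure (Metric.sphere (0 : V3) 1))
        = ∫ ω, (EuclideanSpace.proj (0 : Fin 3)) (I R U ω • (ω : V3))
            ∂(sphereMeasure : Measure (Metric.sphere (0 : V3) 1)) :=
          integral_congr_ae (Eventually.of_forall fun ω => by simp [mul_comm])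
      _ = (EuclideanSpace.proj (0 : Fin 3)) (∫ ω, I R U ω • (ω : V3)
            ∂(sphereMeasure : Measure (Metric.sphere (0 : V3) 1))) :=
          (EuclideanSpace.proj (0 : Fin 3)).integral_comp_comm hint
      _ = g2 (‖U‖ ^ 2) / ‖U‖ * U 0 := by rw [hvec U]; simp
  -- the remainder kernel
  set e : ℝ → ℝ := fun E => g2 E / Real.sqrt E - π / 2 * (((1 + E) ^ 3)⁻¹ * Real.exp (-E / R)) with he
  have hmain : ∀ U : V3, ∫ ω, (ω : V3) 0 * I R U ω ∂(sphereMeasure : Measure (Metric.sphere (0 : V3) 1)) =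
      U 0 * (π / 2 * Θ R U + e (‖U‖ ^ 2)) := by
    intro U
    rw [hΓ₂, he, hΘ]
    dsimp only
    rw [Real.sqrt_sq (norm_nonneg U)]
    ring
  have hee : e = fun E => (∫ ω, (ω : V3) 0 * I R (Real.sqrt E • e₀) ω
      ∂(sphereMeasure : Measure (Metric.sphere (0 : V3) 1))) / Real.sqrt E -
      π / 2 * (((1 + E) ^ 3)⁻¹ * Real.exp (-E / R)) := by
    funext E
    rw [hΓ₂, hnorm _ (Real.sqrt_nonneg E), he]
    have h0 : (Real.sqrt E • e₀) 0 = Real.sqrt E := by simp [he₀]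
    rw [h0]
    rcases le_or_gt E 0 with hE | hE
    · simp [Real.sqrt_eq_zero'.2 hE]
    · rw [Real.sq_sqrt hE.le, div_mul_cancel₀ _ (Real.sqrt_pos.2 hE).ne']
  have hem : Measurable e := by
    rw [hee]
    have hω0 : Continuous fun ω : Metric.sphere (0 : V3) 1 => (ω : V3) 0 :=
      (EuclideanSpace.proj (0 : Fin 3)).continuous.comp continuous_subtype_val
    have hΓm := k2r_ref_ok0_measurable_moment hI hR0 hω0
    have h1 : Measurable fun E : ℝ => Real.sqrt E • e₀ := (Real.continuous_sqrt.smul continuous_const).measurable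
    have h2 : Measurable fun E : ℝ => π / 2 * (((1 + E) ^ 3)⁻¹ * Real.exp (-E / R)) := by fun_prop
    exact ((hΓm.comp h1).div Real.continuous_sqrt.measurable).sub h2
  -- transfer of the one-dimensional estimate
  have hDi' : IntegrableOn (fun E => (1 + E) * E * |e E|) (Ioi 0) := by simpa only [hg2, he] using hDi
  have hDle' : ∫ E in Ioi (0 : ℝ), (1 + E) * E * |e E| ≤ M₂ := by simpa only [hg2, he] using hDle
  obtain ⟨hint, hval⟩ := hpol e hem hDi'
  refine ⟨e, hem, hmain, hint, ?_⟩
  rw [hval]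
  nlinarith [hDle', Real.pi_pos]

omit hΘ hI in
/-- **Registered keyed sub-goal `stub_operatorKappaZero_prep3`** of stub `stub_operatorKappaZero` (line
`refutation` of crux K2R): the two trigonometric remainders of the delocalisation phase on the unit
sphere, `|cos(kω₀) − 1| ≤ k²/2` and `|sin(kω₀) − kω₀| ≤ k³/6` for `0 ≤ k ≤ π/2`. [folklore] -/
theorem stub_operatorKappaZero_prep3 : ∀ k : ℝ, 0 ≤ k → k ≤ Real.pi / 2 → ∀ ω : Metric.sphere (0 : EuclideanSpace ℝ (Fin 3)) 1, |Real.cos (k * (ω : EuclideanSpace ℝ (Fin 3)) 0) - 1| ≤ k ^ 2 / 2 ∧ |Real.sin (k * (ω : EuclideanSpace ℝ (Fin 3)) 0) - k * (ω : EuclideanSpace ℝ (Fin 3)) 0| ≤ k ^ 3 / 6 := by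
  intro k hk0 hk1 ω
  have ht := k2r_ref_coord_mem_Icc ω 0
  have ht2 : ((ω : V3) 0) ^ 2 ≤ 1 := by nlinarith [ht.1, ht.2]
  constructor
  · have h := (k2r_ref_one_sub_cos_bounds hk0 hk1 ht).2
    rw [abs_sub_comm, abs_of_nonneg (by linarith [Real.cos_le_one (k * (ω : V3) 0)])]
    calc 1 - Real.cos (k * (ω : V3) 0) ≤ k ^ 2 / 2 * ((ω : V3) 0) ^ 2 := h
      _ ≤ k ^ 2 / 2 * 1 := by gcongr
      _ = k ^ 2 / 2 := mul_one _
  · have hkt : |k * (ω : V3) 0| ≤ k := by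
      rw [abs_mul, abs_of_nonneg hk0]
      exact mul_le_of_le_one_right hk0 (abs_le.2 ⟨ht.1, ht.2⟩)
    have h3 := pow_le_pow_left₀ (abs_nonneg _) hkt 3
    calc |Real.sin (k * (ω : V3) 0) - k * (ω : V3) 0| ≤ |k * (ω : V3) 0| ^ 3 / 6 := stub_operatorKappaZero_prep _
      _ ≤ k ^ 3 / 6 := by linarith

end Summit.AtomisticToContinuum.HydrodynamicLimit.Theorems.EnskogAdjointDuality
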